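import Summits.BirchSwinnertonDyer.BirchSwinnertonDyer.Theorems.PrintCf2SplitBadEisensteinTwoDivisibilitiesShaBounds
import Summits.BirchSwinnertonDyer.Rank1Residual.P2.HeegnerIndexAtTwoOverKDescent
import HarnessLib

/-!
# Crux `PrintCf2.SplitBadTwoRankOneOfFacts` (item 20368), line `eisenstein_two_bdp_line` v9 — ONE-SIDED DESCENT `K → ℚ` (part 1):
# the UPPER divisibility alone gives the Euler-system HALF of `BSD₂(W)` (`ord₂ #Ш(W) ≤ ord₂ #Ш_an(W)`, `MissingUpperBoundAt W 2`),
# the LOWER divisibility alone gives the Eisenstein HALF (`MissingLowerBoundAt W 2`) — generic one-sided Milne descent (every `p`) + the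
# one-sided `K`-side inputs at `2` from p630199

Cell `bsd-print-cf2`, seat `bsd-line-cf2-p1` g7 (LEAD on crux stmt-BirchSwinnertonDyer-20368). `--supports stmt-BirchSwinnertonDyer-20368`
(helper). Theses-free; THEOREMS ONLY (0 definitions, 0 named facts, 0 `sorry`); CONDITIONAL on every displayed hypothesis. BSD is proved for
no curve by any of this; no summit statement is proved by this seat.

WHY. The registered v9 stubs `stub_upperDivisibility_two` / `stub_lowerDivisibility_two` are one-sided. The two-sided descent of the line
(p629097, via cell bsd-p2's `bsdp_iff_bsdp_twist_of_heegnerIndexOverK`) consumes the EXACT `K`-side identity. This file makes each half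
INDEPENDENTLY productive: Milne's Weil-restriction identity (★) `#Ш_an(E_K)·#Ш(W)·#Ш(Wd) = #Ш_an(W)·#Ш_an(Wd)·#Ш(E_K)` (`shaAnOver_mul_eq`) and
the twin's EXACT `BSD_p(Wd)` transport a ONE-SIDED `K`-side valuation inequality to the same one-sided inequality over `ℚ`, in the tree's
currency `MissingUpperBoundAt` / `MissingLowerBoundAt` (Literature `Rank1Residual/Typed/Basic`).
* §1 `missingUpperBoundAt_of_upperOver_of_bsdp_twist` / `missingLowerBoundAt_of_lowerOver_of_bsdp_twist` — every `p`, any quadratic `K`: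
  `ord_p #Ш(E_K) ≤ ord_p #Ш_an(E_K)` (resp. `≥`) ∧ `BSD_p(Wd)` ⟹ `MissingUpperBoundAt W p` (resp. `MissingLowerBoundAt W p`) — the one-sided
  halves of `bsdp_of_pPartOver_of_bsdp_twist'` (AdditivePotMult/ClassTheorems), same bookkeeping.
* §2 `upperOver_of_upperDivisibility_two` / `lowerOver_of_lowerDivisibility_two` — at a Heegner datum of a curve with `4 ∣ N_W` over `K` with
  `d_K < −4`: frame + one-sided divisibility + control socket ⟹ the one-sided `K`-side input of §1 at `p = 2`, by p630199
  (`sha_add_tamagawa_le/ge_…`) and the exact Gross–Zagier value `#Ш_an(E_K) = 4I²/(c²w²c_K)` (`shaAnOver_baseChange_eq_heegnerIndex_sq`).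
Part 2 (`…DivisibilitiesHalfDescentRoad`) runs the route (Friedberg–Hoffstein field, Heegner point, socket) and concludes the halves of
`BSD₂(W)` class-wide from `stub_upperDivisibility_two` resp. `stub_lowerDivisibility_two` ALONE (with prints, Milne, frames, socket, twin).

References: [Milne1972ArithmeticAV] §1 Thm. 1; [GrossZagier1986] Thm. I.6.3, V.(2.2); [Kolyvagin1990] Thm. A; [Miller2011LMS] Def. 1.1;
[JetchevSkinnerWan2017] §7.4.1.
-/

set_option autoImplicit false

-- D-0017 layout: summit = sub-problem, so `Summit.BirchSwinnertonDyer.BirchSwinnertonDyer.…` is the mandated namespace of Theorems files.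
set_option linter.dupNamespace false

noncomputable section

open scoped Classical MatrixGroups ModularForm Topology NumberField

namespace Summit.BirchSwinnertonDyer.BirchSwinnertonDyer.Theorems.PrintCf2.EisensteinTwo

open Filter CongruenceSubgroup WeierstrassCurve NumberField IsDedekindDomain Field PowerSeries
  Literature.NumberTheory.EllipticCurves Literature.NumberTheory.EllipticCurves.ModularForms
  Literature.NumberTheory.EllipticCurves.LiuZhangZhang2018 Literature.NumberTheory.EllipticCurves.Rank1Residual
  Literature.NumberTheory.EllipticCurves.Rank1Residual.Typed Literature.NumberTheory.EllipticCurves.KrizLi2019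
  Literature.NumberTheory.GaloisRepresentations Literature.NumberTheory.GaloisCohomology
  Summit.BirchSwinnertonDyer.Rank1Residual Summit.BirchSwinnertonDyer.Rank1Residual.X11b
  Summit.BirchSwinnertonDyer.Rank1Residual.X11b.AcSelmer Summit.BirchSwinnertonDyer.Rank1Residual.X11b.CongruenceLimit
  Summit.BirchSwinnertonDyer.Rank1Residual.X11b.Halves Summit.BirchSwinnertonDyer.Rank1Residual.X2
  Summit.BirchSwinnertonDyer.Rank1Residual.Additive Summit.BirchSwinnertonDyer.Rank1Residual.AdditivePotMult
  Summit.BirchSwinnertonDyer.BirchSwinnertonDyer.Theses.UniversalToricDescent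
  Summit.BirchSwinnertonDyer.BirchSwinnertonDyer.Theorems.UniversalToricDescentWaldspurgerFlat

/-! ### §1 One-sided Milne descent `K → ℚ` (every prime `p`) -/

section OneSided

variable (W : WeierstrassCurve ℚ) [W.IsElliptic] [W.IsGloballyMinimal] (p : ℕ) [Fact p.Prime]
  (K : Type) [Field K] [NumberField K]
  (Wd : WeierstrassCurve ℚ) [Wd.IsElliptic] [Wd.IsGloballyMinimal]
  (W' : WeierstrassCurve K) [W'.IsElliptic] [W'.IsGloballyMinimal]

omit [W.IsElliptic] [W.IsGloballyMinimal] [Fact p.Prime] [NumberField K] [Wd.IsElliptic] [Wd.IsGloballyMinimal] [W'.IsElliptic]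
  [W'.IsGloballyMinimal] in
/-- `#Ш_an(V) ≠ 0` for a model `V/ℚ` (modularity: `L^*(V,1) ≠ 0`; torsion, period, Tamagawa product, regulator non-zero). [folklore] -/
theorem shaAn_ne_zero_of_mod (hmod : hasEntireLFunction_rat) (V : WeierstrassCurve ℚ) [V.IsElliptic] : shaAn V ≠ 0 := by
  intro h
  rw [shaAn_def, div_eq_zero_iff] at h
  rcases h with h | h
  · rcases mul_eq_zero.mp h with h | h
    · exact V.leadingLCoeff_ne_zero_holds (hmod V) h
    · exact (pow_ne_zero 2 (by exact_mod_cast V.torsionOrder_pos_holds.ne' : (V.torsionOrder : ℂ) ≠ 0)) h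
  · rcases mul_eq_zero.mp h with h | h
    · rcases mul_eq_zero.mp h with h | h
      · exact (by exact_mod_cast V.realPeriodRat_pos_holds.ne' : (V.realPeriodRat : ℂ) ≠ 0) h
      · exact (by exact_mod_cast V.tamagawaProduct_pos_holds.ne' : (V.tamagawaProduct : ℂ) ≠ 0) h
    · exact (by exact_mod_cast V.regulator_pos'.ne' : (V.regulator : ℂ) ≠ 0) h

/-- **The valuation transport across Milne's identity (★), every `p`.** `W/ℚ` of analytic rank `≤ 1`, `K` quadratic, `Wd` a model of
`W^{(d_K)}` of analytic rank `≤ 1`, `W'` a `K`-model of `W_K`; Milne (`hMilne`) gives `Ш(W')` finite and the Weil-restriction identity, GZK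
(`hGZK`) the finiteness over `ℚ`. If `#Ш_an(W') = q'` is rational and `BSD_p(Wd)` holds, then `#Ш_an(W)` is a rational `q` with
`ord_p q − ord_p #Ш(W) = ord_p q' − ord_p #Ш(W')` — the common core of both one-sided descents (and of the two-sided
`bsdp_of_pPartOver_of_bsdp_twist'`). [cite: Milne1972ArithmeticAV, §1 Thm. 1] [cite: Miller2011LMS, Def. 1.1] -/
theorem exists_shaAn_valuation_sub_eq_of_bsdp_twist
    (hGZK : rank_eq_analyticRank_of_analyticRank_le_one) (hmod : hasEntireLFunction_rat)
    (hMilne : Milne1972.bsdQuotient_baseChange_quadratic)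
    (hr : W.analyticRank ≤ 1) (h2 : Module.finrank ℚ K = 2)
    (hWd : ∃ C : VariableChange ℚ, C • W.quadraticTwist (NumberField.discr K : ℚ) = Wd)
    (hrd : Wd.analyticRank ≤ 1)
    (hW' : ∃ C : VariableChange K, C • W.baseChange K = W')
    {q' : ℚ} (hq' : shaAnOver W' = (q' : ℂ)) (hd : BSDp Wd p) :
    ∃ q : ℚ, shaAn W = (q : ℂ) ∧
      padicValRat p q - (padicValNat p W.shaOrder : ℤ) = padicValRat p q' - (padicValNat p W'.shaOrder : ℤ) := by
  obtain ⟨-, hfinW⟩ := hGZK W hr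
  obtain ⟨-, hfinD⟩ := hGZK Wd hrd
  haveI : Finite W.sha := hfinW
  haveI : Finite Wd.sha := hfinD
  obtain ⟨hshaK, hWR⟩ := hMilne W K h2 Wd hWd W' hW' hfinW hfinD
  -- the twin, in Miller's currency
  obtain ⟨qd, hqd, hvd⟩ := missingPPartAt_of_bsdp Wd p hd
  -- (★)
  have hstar := shaAnOver_mul_eq W K Wd W' hmod h2 hWd hW' hfinW hfinD hshaK hWR
  -- non-vanishing
  have hsW : W.shaOrder ≠ 0 := (W.shaOrder_pos hfinW).ne'
  have hsD : Wd.shaOrder ≠ 0 := (Wd.shaOrder_pos hfinD).ne'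
  have hsK : W'.shaOrder ≠ 0 := (W'.shaOrder_pos hshaK).ne'
  have hqd0 : qd ≠ 0 := by
    intro h0; exact shaAn_ne_zero_of_mod hmod Wd (by rw [hqd, h0, Rat.cast_zero])
  have hq'0 : q' ≠ 0 := by
    intro h0
    have : shaAn W * shaAn Wd * (W'.shaOrder : ℂ) = 0 := by
      rw [← hstar, hq', h0]; simp
    rcases mul_eq_zero.mp this with h | h
    · rcases mul_eq_zero.mp h with h | h
      · exact shaAn_ne_zero_of_mod hmod W h
      · exact shaAn_ne_zero_of_mod hmod Wd h
    · exact hsK (by exact_mod_cast h)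
  -- solve (★) for `#Ш_an(W)`
  set q : ℚ := q' * W.shaOrder * Wd.shaOrder / (W'.shaOrder * qd) with hq_def
  have hshaAn : shaAn W = (q : ℂ) := by
    have hden : (W'.shaOrder : ℂ) * (qd : ℂ) ≠ 0 :=
      mul_ne_zero (by exact_mod_cast hsK) (by exact_mod_cast hqd0)
    rw [hq_def]
    push_cast
    rw [eq_div_iff hden, ← hqd, ← hq']
    linear_combination -hstar
  refine ⟨q, hshaAn, ?_⟩
  -- valuations
  have hsWq : (W.shaOrder : ℚ) ≠ 0 := by exact_mod_cast hsW
  have hsDq : (Wd.shaOrder : ℚ) ≠ 0 := by exact_mod_cast hsD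
  have hsKq : (W'.shaOrder : ℚ) ≠ 0 := by exact_mod_cast hsK
  rw [hq_def, padicValRat.div (mul_ne_zero (mul_ne_zero hq'0 hsWq) hsDq) (mul_ne_zero hsKq hqd0),
    padicValRat.mul (mul_ne_zero hq'0 hsWq) hsDq, padicValRat.mul hq'0 hsWq,
    padicValRat.mul hsKq hqd0, hvd, padicValRat.of_nat, padicValRat.of_nat, padicValRat.of_nat]
  ring

/-- **One-sided descent, Euler-system half (every `p`).** In the setting of `exists_shaAn_valuation_sub_eq_of_bsdp_twist`: the `K`-side UPPER
half `ord_p #Ш(W') ≤ ord_p #Ш_an(W')` and the twin's `BSD_p(Wd)` give the UPPER half over `ℚ`, `MissingUpperBoundAt W p`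
(`ord_p #Ш(W) ≤ ord_p #Ш_an(W)`, `#Ш_an(W)` rational). [cite: Milne1972ArithmeticAV, §1 Thm. 1] [cite: Kolyvagin1990, Thm. A (shape)]
[cite: Miller2011LMS, Def. 1.1] -/
theorem missingUpperBoundAt_of_upperOver_of_bsdp_twist
    (hGZK : rank_eq_analyticRank_of_analyticRank_le_one) (hmod : hasEntireLFunction_rat)
    (hMilne : Milne1972.bsdQuotient_baseChange_quadratic)
    (hr : W.analyticRank ≤ 1) (h2 : Module.finrank ℚ K = 2)
    (hWd : ∃ C : VariableChange ℚ, C • W.quadraticTwist (NumberField.discr K : ℚ) = Wd)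
    (hrd : Wd.analyticRank ≤ 1)
    (hW' : ∃ C : VariableChange K, C • W.baseChange K = W')
    (hKup : ∃ q' : ℚ, shaAnOver W' = (q' : ℂ) ∧ (padicValNat p W'.shaOrder : ℤ) ≤ padicValRat p q')
    (hd : BSDp Wd p) : MissingUpperBoundAt W p := by
  obtain ⟨q', hq', hle⟩ := hKup
  obtain ⟨q, hq, hv⟩ := exists_shaAn_valuation_sub_eq_of_bsdp_twist W p K Wd W' hGZK hmod hMilne hr h2 hWd hrd hW' hq' hd
  exact ⟨q, hq, by linarith⟩

/-- **One-sided descent, Eisenstein half (every `p`).** The `K`-side LOWER half `ord_p #Ш_an(W') ≤ ord_p #Ш(W')` and the twin's `BSD_p(Wd)`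
give the LOWER half over `ℚ`, `MissingLowerBoundAt W p` (`ord_p #Ш_an(W) ≤ ord_p #Ш(W)`). [cite: Milne1972ArithmeticAV, §1 Thm. 1]
[cite: Miller2011LMS, Def. 1.1] -/
theorem missingLowerBoundAt_of_lowerOver_of_bsdp_twist
    (hGZK : rank_eq_analyticRank_of_analyticRank_le_one) (hmod : hasEntireLFunction_rat)
    (hMilne : Milne1972.bsdQuotient_baseChange_quadratic)
    (hr : W.analyticRank ≤ 1) (h2 : Module.finrank ℚ K = 2)
    (hWd : ∃ C : VariableChange ℚ, C • W.quadraticTwist (NumberField.discr K : ℚ) = Wd)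
    (hrd : Wd.analyticRank ≤ 1)
    (hW' : ∃ C : VariableChange K, C • W.baseChange K = W')
    (hKlo : ∃ q' : ℚ, shaAnOver W' = (q' : ℂ) ∧ padicValRat p q' ≤ (padicValNat p W'.shaOrder : ℤ))
    (hd : BSDp Wd p) : MissingLowerBoundAt W p := by
  obtain ⟨q', hq', hle⟩ := hKlo
  obtain ⟨q, hq, hv⟩ := exists_shaAn_valuation_sub_eq_of_bsdp_twist W p K Wd W' hGZK hmod hMilne hr h2 hWd hrd hW' hq' hd
  exact ⟨q, hq, by linarith⟩

end OneSided

/-! ### §2 The one-sided `K`-side inputs at `p = 2` from the one-sided divisibilities (Heegner datum, `d_K < −4`) -/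

section KSide

/-- **UPPER divisibility + socket ⟹ the `K`-side Euler-system half `ord₂ #Ш(E_K) ≤ ord₂ #Ш_an(E_K)`** (with `#Ш_an(E_K) = 4I²/(c²w²c_K)` rational,
Gross–Zagier + Kolyvagin, `shaAnOver_baseChange_eq_heegnerIndex_sq`). Data as in `sha_add_tamagawa_le_of_upperDivisibility_two` (p630199) plus the
Gross–Zagier / Kolyvagin / modularity binders of the exact value and `(W.baseChange K).analyticRank = 1`. `w_K = 2` from `d_K < −4`.
CONDITIONAL on `hL`, `hGZ`, `hKo`, `hmod`. [cite: GrossZagier1986, Thm. I.6.3 and V.(2.2)] [cite: Kolyvagin1990, Thm. A] -/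
theorem upperOver_of_upperDivisibility_two
    (hL : thm151_thm153_modularCurve_heegnerVector_additive) (hmod : hasEntireLFunction_rat)
    (W : WeierstrassCurve ℚ) [W.IsElliptic] [W.IsGloballyMinimal]
    (K : Type) [Field K] [NumberField K]
    (κ : ZpExtension K 2) (γ : absoluteGaloisGroup K) [Fact (κ.IsTopGenerator γ)] {N : ℕ} [NeZero N]
    (Dt : ModularParametrizationData W N) (H : HeegnerDatum N (NumberField.discr K))
    (ιK : K →+* ℂ) (P : (W.baseChange K).toAffine.Point)
    (hGZ : gross_zagier N W K) (hKo : kolyvagin N W K)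
    (hN : W.conductorNorm ℤ = N) (h4N : 2 ^ 2 ∣ N) (hK : IsImaginaryQuadratic K)
    (hd4 : NumberField.discr K < -4) (hHN : SatisfiesHeegnerHypothesis N K) (hκ : κ.IsAnticyclotomic)
    (hP : WeierstrassCurve.Affine.Point.map ιK.toRatAlgHom P = heegnerPointComplex Dt H)
    (hPinf : ¬ IsOfFinAddOrder P) (hrk : (W.baseChange K).mordellWeilRank = 1) (hrK : (W.baseChange K).analyticRank = 1)
    (𝔭 : HeightOneSpectrum (𝓞 K)) (h𝔭 : ((2 : ℕ) : 𝓞 K) ∈ 𝔭.asIdeal) (he : 𝔭.asIdeal.ramificationIdx (𝓞 ℚ) = 1)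
    (hf : 𝔭.asIdeal.inertiaDeg (𝓞 ℚ) = 1)
    (𝔭' : HeightOneSpectrum (𝓞 K)) (h𝔭' : ((2 : ℕ) : 𝓞 K) ∈ 𝔭'.asIdeal) (he' : 𝔭'.asIdeal.ramificationIdx (𝓞 ℚ) = 1)
    (hf' : 𝔭'.asIdeal.inertiaDeg (𝓞 ℚ) = 1)
    (ι' : PadicAlgCl 2 ≃+* ℂ) (hind : SchneiderFree.BranchInducesPrime 2 ι' 𝔭)
    {ΩK' : ℂ} {Ωp' : ℂ_[2]} {Q : PowerSeries (PadicComplexInt 2)} (hΩK' : ΩK' ≠ 0) (hΩp' : Ωp' ≠ 0)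
    (hQ : R1.IsBDPLFunctionInt 2 ι' 𝔭 κ γ Dt.f ΩK' Ωp' Q)
    (hU : ∃ h : PowerSeries (PadicComplexInt 2), ‖((constantCoeff h : PadicComplexInt 2) : ℂ_[2])‖ ≤ 2⁻¹ ∧
      Ideal.span {Q} ≤ Ideal.span {h} * (XAc.charIdeal (W.baseChange K) 2 κ 𝔭' ∅ γ).map (PowerSeries.map (R1.toCpInt 2)))
    (hctl : SchneiderFree.AdditiveControlOnTreeAt 2 κ 𝔭' γ (embAt K 2 𝔭' h𝔭' he' hf') P) :
    ∃ q' : ℚ, shaAnOver (W.baseChange K) = (q' : ℂ) ∧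
      (padicValNat 2 (W.baseChange K).shaOrder : ℤ) ≤ padicValRat 2 q' := by
  have hc0 : Dt.c ≠ 0 := Dt.maninConstant_ne_zero_holds
  obtain ⟨-, hShaK, hval⟩ := Summit.BirchSwinnertonDyer.Rank1Residual.P2.shaAnOver_baseChange_eq_heegnerIndex_sq W N K Dt H ιK P
    hGZ hKo hmod hK hHN hP hc0 hrK
  haveI : Finite (W.baseChange K).sha := hShaK
  have hbound := sha_add_tamagawa_le_of_upperDivisibility_two hL W K κ γ Dt H ιK P hN h4N hK hd4 hHN hκ hP hPinf hrk 𝔭 h𝔭 he hf 𝔭'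
    h𝔭' he' hf' ι' hind hΩK' hΩp' hQ hU hctl
  refine ⟨_, hval, ?_⟩
  -- `ord₂ (4 I²/(c² w² c_K)) = 2 + 2·ord₂ I − (2·ord₂ c + 2 + ord₂ c_K)` with `w_K = 2`
  set I : ℕ := (AddSubgroup.zmultiples P).index with hI_def
  have hw2 : Units.torsionOrder K = 2 :=
    Literature.NumberTheory.QuadraticFields.Quadratic.torsionOrder_eq_two_of_discr_lt_neg_four hK.1 hd4
  have hheight := Summit.BirchSwinnertonDyer.Rank1Residual.P2.torsionOrder_sq_mul_canonicalHeight_eq_index_sq_mul_regulator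
    (W.baseChange K) hrk P hPinf
  have htK : 0 < (W.baseChange K).torsionOrder := (W.baseChange K).torsionOrder_pos_holds
  have hI0 : I ≠ 0 := by
    intro hI
    rw [← hI_def, hI] at hheight
    have h0 : ((W.baseChange K).torsionOrder : ℝ) ^ 2 * P.canonicalHeight = 0 := by rw [hheight]; simp
    rcases mul_eq_zero.mp h0 with h' | h'
    · exact absurd ((pow_eq_zero_iff two_ne_zero).mp h') (by exact_mod_cast htK.ne')
    · exact hPinf ((Affine.Point.canonicalHeight_eq_zero_iff_holds P).mp h')
  have hcK : 0 < (W.baseChange K).tamagawaProduct := (W.baseChange K).tamagawaProduct_pos_holds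
  have hIQ : (I : ℚ) ≠ 0 := by exact_mod_cast hI0
  have hcQ : (Dt.c : ℚ) ≠ 0 := by exact_mod_cast hc0
  have hwQ : (Units.torsionOrder K : ℚ) ≠ 0 := by rw [hw2]; norm_num
  have hcKQ : ((W.baseChange K).tamagawaProduct : ℚ) ≠ 0 := by exact_mod_cast hcK.ne'
  have hsha : padicValNat 2 (Nat.card (AddCommGroup.primaryComponent (W.baseChange K).sha 2)) =
      padicValNat 2 (W.baseChange K).shaOrder :=
    Literature.NumberTheory.EllipticCurves.padicValNat_card_addPrimaryComponent 2
  have hcval : padicValRat 2 (Dt.c : ℚ) = (padicValNat 2 Dt.c.natAbs : ℤ) := by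
    rw [padicValRat.of_int]; rfl
  have h2val : padicValRat 2 (((2 : ℕ) : ℚ)) = 1 := by
    rw [padicValRat.of_nat, padicValNat_self]; rfl
  have h4val : padicValRat 2 (4 : ℚ) = 2 := by
    rw [show (4 : ℚ) = ((2 : ℕ) : ℚ) ^ 2 by norm_num, padicValRat.pow, h2val]; norm_num
  have hLHS : padicValRat 2 (4 * (I : ℚ) ^ 2 / ((Dt.c : ℚ) ^ 2 * (Units.torsionOrder K : ℚ) ^ 2 *
      ((W.baseChange K).tamagawaProduct : ℚ))) =
      2 + 2 * (padicValNat 2 I : ℤ) - (2 * (padicValNat 2 Dt.c.natAbs : ℤ) + 2 * 1 +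
        (padicValNat 2 (W.baseChange K).tamagawaProduct : ℤ)) := by
    rw [padicValRat.div (mul_ne_zero (by norm_num) (pow_ne_zero 2 hIQ))
        (mul_ne_zero (mul_ne_zero (pow_ne_zero 2 hcQ) (pow_ne_zero 2 hwQ)) hcKQ),
      padicValRat.mul (by norm_num) (pow_ne_zero 2 hIQ), padicValRat.mul (mul_ne_zero (pow_ne_zero 2 hcQ) (pow_ne_zero 2 hwQ)) hcKQ,
      padicValRat.mul (pow_ne_zero 2 hcQ) (pow_ne_zero 2 hwQ), padicValRat.pow, padicValRat.pow, padicValRat.pow, h4val, hw2, hcval,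
      h2val, padicValRat.of_nat, padicValRat.of_nat]
    push_cast
    ring
  rw [hLHS, ← hsha]
  linarith

/-- **LOWER divisibility + socket ⟹ the `K`-side Eisenstein half `ord₂ #Ш_an(E_K) ≤ ord₂ #Ш(E_K)`.** Same data with the LOWER divisibility.
CONDITIONAL on `hL`, `hGZ`, `hKo`, `hmod`. [cite: GrossZagier1986, Thm. I.6.3 and V.(2.2)] [cite: JetchevSkinnerWan2017, §7.4.1 (shape)] -/
theorem lowerOver_of_lowerDivisibility_two
    (hL : thm151_thm153_modularCurve_heegnerVector_additive) (hmod : hasEntireLFunction_rat)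
    (W : WeierstrassCurve ℚ) [W.IsElliptic] [W.IsGloballyMinimal]
    (K : Type) [Field K] [NumberField K]
    (κ : ZpExtension K 2) (γ : absoluteGaloisGroup K) [Fact (κ.IsTopGenerator γ)] {N : ℕ} [NeZero N]
    (Dt : ModularParametrizationData W N) (H : HeegnerDatum N (NumberField.discr K))
    (ιK : K →+* ℂ) (P : (W.baseChange K).toAffine.Point)
    (hGZ : gross_zagier N W K) (hKo : kolyvagin N W K)
    (hN : W.conductorNorm ℤ = N) (h4N : 2 ^ 2 ∣ N) (hK : IsImaginaryQuadratic K)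
    (hd4 : NumberField.discr K < -4) (hHN : SatisfiesHeegnerHypothesis N K) (hκ : κ.IsAnticyclotomic)
    (hP : WeierstrassCurve.Affine.Point.map ιK.toRatAlgHom P = heegnerPointComplex Dt H)
    (hPinf : ¬ IsOfFinAddOrder P) (hrk : (W.baseChange K).mordellWeilRank = 1) (hrK : (W.baseChange K).analyticRank = 1)
    (𝔭 : HeightOneSpectrum (𝓞 K)) (h𝔭 : ((2 : ℕ) : 𝓞 K) ∈ 𝔭.asIdeal) (he : 𝔭.asIdeal.ramificationIdx (𝓞 ℚ) = 1)
    (hf : 𝔭.asIdeal.inertiaDeg (𝓞 ℚ) = 1)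
    (𝔭' : HeightOneSpectrum (𝓞 K)) (h𝔭' : ((2 : ℕ) : 𝓞 K) ∈ 𝔭'.asIdeal) (he' : 𝔭'.asIdeal.ramificationIdx (𝓞 ℚ) = 1)
    (hf' : 𝔭'.asIdeal.inertiaDeg (𝓞 ℚ) = 1)
    (ι' : PadicAlgCl 2 ≃+* ℂ) (hind : SchneiderFree.BranchInducesPrime 2 ι' 𝔭)
    {ΩK' : ℂ} {Ωp' : ℂ_[2]} {Q : PowerSeries (PadicComplexInt 2)} (hΩK' : ΩK' ≠ 0) (hΩp' : Ωp' ≠ 0)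
    (hQ : R1.IsBDPLFunctionInt 2 ι' 𝔭 κ γ Dt.f ΩK' Ωp' Q)
    (hLo : ∃ g : PowerSeries (PadicComplexInt 2), 2⁻¹ ≤ ‖((constantCoeff g : PadicComplexInt 2) : ℂ_[2])‖ ∧
      Ideal.span {g} * (XAc.charIdeal (W.baseChange K) 2 κ 𝔭' ∅ γ).map (PowerSeries.map (R1.toCpInt 2)) ≤ Ideal.span {Q})
    (hctl : SchneiderFree.AdditiveControlOnTreeAt 2 κ 𝔭' γ (embAt K 2 𝔭' h𝔭' he' hf') P) :
    ∃ q' : ℚ, shaAnOver (W.baseChange K) = (q' : ℂ) ∧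
      padicValRat 2 q' ≤ (padicValNat 2 (W.baseChange K).shaOrder : ℤ) := by
  have hc0 : Dt.c ≠ 0 := Dt.maninConstant_ne_zero_holds
  obtain ⟨-, hShaK, hval⟩ := Summit.BirchSwinnertonDyer.Rank1Residual.P2.shaAnOver_baseChange_eq_heegnerIndex_sq W N K Dt H ιK P
    hGZ hKo hmod hK hHN hP hc0 hrK
  haveI : Finite (W.baseChange K).sha := hShaK
  have hbound := sha_add_tamagawa_ge_of_lowerDivisibility_two hL W K κ γ Dt H ιK P hN h4N hK hd4 hHN hκ hP hPinf hrk 𝔭 h𝔭 he hf 𝔭'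
    h𝔭' he' hf' ι' hind hΩK' hΩp' hQ hLo hctl
  refine ⟨_, hval, ?_⟩
  set I : ℕ := (AddSubgroup.zmultiples P).index with hI_def
  have hw2 : Units.torsionOrder K = 2 :=
    Literature.NumberTheory.QuadraticFields.Quadratic.torsionOrder_eq_two_of_discr_lt_neg_four hK.1 hd4
  have hheight := Summit.BirchSwinnertonDyer.Rank1Residual.P2.torsionOrder_sq_mul_canonicalHeight_eq_index_sq_mul_regulator
    (W.baseChange K) hrk P hPinf
  have htK : 0 < (W.baseChange K).torsionOrder := (W.baseChange K).torsionOrder_pos_holds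
  have hI0 : I ≠ 0 := by
    intro hI
    rw [← hI_def, hI] at hheight
    have h0 : ((W.baseChange K).torsionOrder : ℝ) ^ 2 * P.canonicalHeight = 0 := by rw [hheight]; simp
    rcases mul_eq_zero.mp h0 with h' | h'
    · exact absurd ((pow_eq_zero_iff two_ne_zero).mp h') (by exact_mod_cast htK.ne')
    · exact hPinf ((Affine.Point.canonicalHeight_eq_zero_iff_holds P).mp h')
  have hcK : 0 < (W.baseChange K).tamagawaProduct := (W.baseChange K).tamagawaProduct_pos_holds
  have hIQ : (I : ℚ) ≠ 0 := by exact_mod_cast hI0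
  have hcQ : (Dt.c : ℚ) ≠ 0 := by exact_mod_cast hc0
  have hwQ : (Units.torsionOrder K : ℚ) ≠ 0 := by rw [hw2]; norm_num
  have hcKQ : ((W.baseChange K).tamagawaProduct : ℚ) ≠ 0 := by exact_mod_cast hcK.ne'
  have hsha : padicValNat 2 (Nat.card (AddCommGroup.primaryComponent (W.baseChange K).sha 2)) =
      padicValNat 2 (W.baseChange K).shaOrder :=
    Literature.NumberTheory.EllipticCurves.padicValNat_card_addPrimaryComponent 2
  have hcval : padicValRat 2 (Dt.c : ℚ) = (padicValNat 2 Dt.c.natAbs : ℤ) := by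
    rw [padicValRat.of_int]; rfl
  have h2val : padicValRat 2 (((2 : ℕ) : ℚ)) = 1 := by
    rw [padicValRat.of_nat, padicValNat_self]; rfl
  have h4val : padicValRat 2 (4 : ℚ) = 2 := by
    rw [show (4 : ℚ) = ((2 : ℕ) : ℚ) ^ 2 by norm_num, padicValRat.pow, h2val]; norm_num
  have hLHS : padicValRat 2 (4 * (I : ℚ) ^ 2 / ((Dt.c : ℚ) ^ 2 * (Units.torsionOrder K : ℚ) ^ 2 *
      ((W.baseChange K).tamagawaProduct : ℚ))) =
      2 + 2 * (padicValNat 2 I : ℤ) - (2 * (padicValNat 2 Dt.c.natAbs : ℤ) + 2 * 1 +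
        (padicValNat 2 (W.baseChange K).tamagawaProduct : ℤ)) := by
    rw [padicValRat.div (mul_ne_zero (by norm_num) (pow_ne_zero 2 hIQ))
        (mul_ne_zero (mul_ne_zero (pow_ne_zero 2 hcQ) (pow_ne_zero 2 hwQ)) hcKQ),
      padicValRat.mul (by norm_num) (pow_ne_zero 2 hIQ), padicValRat.mul (mul_ne_zero (pow_ne_zero 2 hcQ) (pow_ne_zero 2 hwQ)) hcKQ,
      padicValRat.mul (pow_ne_zero 2 hcQ) (pow_ne_zero 2 hwQ), padicValRat.pow, padicValRat.pow, padicValRat.pow, h4val, hw2, hcval,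
      h2val, padicValRat.of_nat, padicValRat.of_nat]
    push_cast
    ring
  rw [hLHS, ← hsha]
  linarith

end KSide

end Summit.BirchSwinnertonDyer.BirchSwinnertonDyer.Theorems.PrintCf2.EisensteinTwo

end
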